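import Summits.ResolutionOfSingularities.ResolutionOfSingularities.Theorems.FrobeniusClosingPatchingRelPerfectMonomialRouteKCharts
import Literature.AlgebraicGeometry.Resolution.KollarBlowupSequenceFunctors
import HarnessLib

/-!
# Crux `PatchingRelPerfect` (stmt-ResolutionOfSingularities-16161), chain w52 — TargetsF3 (m)
# «M2-strong», COMBINATORIAL HALF, Route K step K9: the TORIC ATLAS invariant of a level of the
# tower and what it yields — the head centre is a disjoint family of PERMISSIBLE strata, and an
# exhausted sequence is a LOCAL WIN

[OURS · L1 W5.2 · design memo v3 (`L/res-type-075/M2STRONG-COMBINATORIAL-HALF.md`); fact-free;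
nothing here is a statement of the manuscript under review]

`Good L m s Y D M 𝔱 𝒞` is the invariant tying a (simplex-born) game state `s` to a level `Y` of the
blow-up tower over `𝔸^{B₀}_ℚ` (`B₀ = L`): boundary ideal sheaves `D l` (`l` a game index), the current
marked ideal `M` (Kollár's transform, marking `m`) with the REMAINING functorial sequence `𝔱`
resolving it, and an atlas `𝒞` of toric charts (file K8) such that: each chart reads `D (lab b)` as
`(x_b)` and `M` as the monomial ideal of `s.A` (C1/G2), a chart is exactly the set of points all of
whose boundary divisors are labelled in its cone (IMG), charts cover points and strata (COV), and every
torus scaling of a chart is induced by an automorphism of `Y` along which `𝔱` is its own pull-back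
and all `D l` are stable (C2').  Consequences proved here:

* `img_head_stable`, `exists_sees_or_top` — the head centre `C` of `𝔱` is read in every chart as ONE
  coordinate stratum `(x_S)` or as empty (files K7/K8);
* `labels_point_coordIdeal` — the exact point of a stratum in a chart; `Sees.of_subset_cone` —
  CONSISTENCY: a chart whose cone contains a component of `C` sees it;
* `components` (`𝒥`), `permissibleM_of_mem_components`, `union_not_mem_of_ne` — the components of
  the head centre are permissible strata, pairwise not faces of a common stratum, and
  `components_nonempty`.  (The read-out of an EXHAUSTED sequence as a local win is in the next file.)
-/

-- `Summit.<Summit>.<Sub>.Theorems` with `Sub = Summit` (single-conjunct summit, D-0017)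
set_option linter.dupNamespace false

noncomputable section

open CategoryTheory AlgebraicGeometry TopologicalSpace IsLocalRing
open Literature.AlgebraicGeometry.Resolution

namespace Summit.ResolutionOfSingularities.ResolutionOfSingularities.Theorems

namespace PolyhedraGame

namespace RouteK

universe u

variable {L : Finset ℕ}

/-- [OURS] The game indices of a set of variables of a chart. -/
def Chart.labels {Y : Scheme.{u}} (c : Chart L Y) (S : Finset L) : Finset ℕ := S.image fun b : L => c.lab b

/-- [OURS] Labels lie in the cone. -/
theorem Chart.labels_subset_cone {Y : Scheme.{u}} (c : Chart L Y) (S : Finset L) : c.labels S ⊆ c.cone := by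
  intro l hl
  obtain ⟨b, -, rfl⟩ := Finset.mem_image.mp hl
  exact Finset.mem_image_of_mem _ b.2

/-- [OURS] With an injective labelling, `lab b` is a label of `S` iff `b ∈ S`. -/
theorem Chart.lab_mem_labels_iff {Y : Scheme.{u}} (c : Chart L Y) (hinj : Set.InjOn c.lab L)
    (S : Finset L) (b : L) : c.lab b ∈ c.labels S ↔ b ∈ S := by
  constructor
  · intro h
    obtain ⟨b', hb', hbb'⟩ := Finset.mem_image.mp h
    have : (b' : ℕ) = b := hinj b'.2 b.2 hbb'
    rwa [← Subtype.ext this]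
  · exact fun h => Finset.mem_image_of_mem _ h

/-- [OURS] With an injective labelling, the weight on the labels of `S` is the `S`-degree of the chart
exponent. -/
theorem Chart.weight_labels {Y : Scheme.{u}} (c : Chart L Y) (hinj : Set.InjOn c.lab L)
    (S : Finset L) (α : ℕ →₀ ℕ) : weight (c.labels S) α = sdeg S (c.expOf α) := by
  unfold weight sdeg Chart.labels
  rw [Finset.sum_image]
  · rfl
  · intro x _ y _ h
    exact Subtype.ext (hinj x.2 y.2 h)

/-! ## The invariant -/

/-- [OURS · W5.2 M2-strong · Route K] **The toric atlas invariant** of a level of the tower (see the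
module docstring). -/
structure Good (L : Finset ℕ) (m : ℕ) (s : State) (Y : Scheme.{u}) (D : ℕ → Y.IdealSheafData)
    (M : MarkedIdeal Y) (𝔱 : CentreSeq Y) (𝒞 : Set (Chart L Y)) : Prop where
  /-- the level is locally Noetherian -/
  locNoeth : IsLocallyNoetherian Y
  /-- the marking -/
  mult : M.mult = m
  /-- the remaining functorial sequence resolves the current marked ideal -/
  res : 𝔱.IsResolutionOf M
  /-- it has no empty blow-ups -/
  noEmpty : 𝔱.NoEmptyCentres
  /-- indices that are not live carry the unit ideal sheaf -/
  D_top : ∀ l, l ∉ s.B → D l = ⊤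
  /-- labellings are injective -/
  lab_inj : ∀ c ∈ 𝒞, Set.InjOn c.lab (L : Set ℕ)
  /-- the cone of a chart is a stratum -/
  cone_mem : ∀ c ∈ 𝒞, c.cone ∈ s.Str
  /-- every stratum lies in the cone of a chart -/
  cov_str : ∀ T ∈ s.Str, ∃ c ∈ 𝒞, T ⊆ c.cone
  /-- the charts cover -/
  cov_pts : ∀ y : Y, ∃ c ∈ 𝒞, y ∈ (c.U : Y.Opens)
  /-- (C1) the variable `x_b` cuts out the divisor `lab b` -/
  img_D : ∀ c ∈ 𝒞, ∀ b : L, c.img (D (c.lab b)) = Ideal.span {(MvPolynomial.X b : MvPolynomial L ℚ)}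
  /-- (C1') divisors not labelled in the cone do not meet the chart -/
  img_D_top : ∀ c ∈ 𝒞, ∀ l, l ∉ c.cone → c.img (D l) = ⊤
  /-- (G2) the current ideal is the monomial ideal of the exponent vectors -/
  img_M : ∀ c ∈ 𝒞, c.img M.ideal = c.monIdeal s.A
  /-- (IMG) the chart is the set of points whose divisors are labelled in its cone -/
  mem_U_iff : ∀ c ∈ 𝒞, ∀ y : Y, y ∈ (c.U : Y.Opens) ↔ ∀ l, y ∈ (D l).support → l ∈ c.cone
  /-- (C2') torus scalings of a chart come from automorphisms stabilising `𝔱` and the boundary -/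
  sym : ∀ c ∈ 𝒞, ∀ t : L → ℚ, (∀ b, t b ≠ 0) →
    ∃ (g : Y ≅ Y) (h : (c.U : Y.Opens) ≤ g.hom ⁻¹ᵁ (c.U : Y.Opens)),
      (∀ f, c.e ((g.hom.appLE c.U c.U h).hom f) = scaleHom t (c.e f)) ∧
      CentreSeq.IsPullbackAlong g.hom 𝔱 𝔱 ∧ ∀ l, (D l).comap g.hom = D l

namespace Good

variable {m : ℕ} {s : State} {Y : Scheme.{u}} {D : ℕ → Y.IdealSheafData} {M : MarkedIdeal Y}
  {𝒞 : Set (Chart L Y)}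

/-! ## Points of a chart; the exact point of a stratum -/

/-- [OURS] Every point of a chart is the point of a prime of the polynomial ring. -/
theorem exists_point_eq (c : Chart L Y) {y : Y} (hy : y ∈ (c.U : Y.Opens)) :
    ∃ (P : Ideal (MvPolynomial L ℚ)) (_ : P.IsPrime), c.point P = y := by
  let q := c.U.2.primeIdealOf ⟨y, hy⟩
  refine ⟨q.asIdeal.comap (c.e.symm : MvPolynomial L ℚ →+* Γ(Y, c.U)), Ideal.IsPrime.comap _, ?_⟩
  have hq : c.primeOf (q.asIdeal.comap (c.e.symm : MvPolynomial L ℚ →+* Γ(Y, c.U))) = q := by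
    apply PrimeSpectrum.ext
    change (q.asIdeal.comap (c.e.symm : MvPolynomial L ℚ →+* Γ(Y, c.U))).comap
      (c.e : Γ(Y, c.U) →+* MvPolynomial L ℚ) = q.asIdeal
    rw [Ideal.comap_comap]
    convert Ideal.comap_id q.asIdeal
    ext x
    simp
  change c.U.2.fromSpec (c.primeOf _) = y
  rw [hq]
  exact c.U.2.fromSpec_primeIdealOf ⟨y, hy⟩

section General

variable {𝔱 : CentreSeq Y} (G : Good L m s Y D M 𝔱 𝒞)
include G

/-- [OURS] `X b ∈ (x_S) ↔ b ∈ S`. -/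
theorem X_mem_coordIdeal_iff [DecidableEq L] (S : Finset L) (b : L) :
    (MvPolynomial.X b : MvPolynomial L ℚ) ∈ coordIdeal S ↔ b ∈ S := by
  have _ := G
  rw [mem_coordIdeal_iff]
  classical
  rw [MvPolynomial.support_X]
  simp only [Finset.mem_singleton, forall_eq, one_le_sdeg_iff, Finsupp.single_apply, ne_eq,
    ite_eq_right_iff, one_ne_zero, imp_false, not_not]
  constructor
  · rintro ⟨i, hi, rfl⟩; exact hi
  · exact fun h => ⟨b, h, rfl⟩

/-- [OURS] **The divisors through the exact point of a stratum**: the point of the chart at `(x_S)`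
lies on `D l` iff `l` is a label of `S`. -/
theorem point_coordIdeal_mem_support_iff [DecidableEq L] {c : Chart L Y} (hc : c ∈ 𝒞) (S : Finset L)
    (l : ℕ) :
    (haveI := coordIdeal_isPrime (K := ℚ) S; c.point (coordIdeal S)) ∈ (D l).support ↔ l ∈ c.labels S := by
  haveI := coordIdeal_isPrime (K := ℚ) S
  rw [c.point_mem_support_iff]
  by_cases hl : l ∈ c.cone
  · obtain ⟨b, hbL, rfl⟩ := Finset.mem_image.mp hl
    rw [G.img_D c hc ⟨b, hbL⟩, Ideal.span_singleton_le_iff_mem, G.X_mem_coordIdeal_iff]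
    exact (c.lab_mem_labels_iff (G.lab_inj c hc) S ⟨b, hbL⟩).symm
  · rw [G.img_D_top c hc l hl]
    constructor
    · intro h; exact absurd (top_le_iff.mp h) (Ideal.IsPrime.ne_top inferInstance)
    · intro h; exact absurd (c.labels_subset_cone S h) hl

/-- [OURS] The exact point of a stratum of one chart lies in every chart whose cone contains the
stratum. -/
theorem point_coordIdeal_mem_U [DecidableEq L] {c c' : Chart L Y} (hc : c ∈ 𝒞) (hc' : c' ∈ 𝒞)
    (S : Finset L) (h : c.labels S ⊆ c'.cone) :
    (haveI := coordIdeal_isPrime (K := ℚ) S; c.point (coordIdeal S)) ∈ (c'.U : Y.Opens) := by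
  rw [G.mem_U_iff c' hc']
  intro l hl
  exact h ((G.point_coordIdeal_mem_support_iff hc S l).mp hl)

end General

/-! ## The head centre read in the charts -/

section Head

variable {C : Y.IdealSheafData} {rest : CentreSeq (blowup C)} (G : Good L m s Y D M (CentreSeq.cons C rest) 𝒞)
include G

/-- [OURS] The head centre is a regular scheme. -/
theorem isRegular_head : Scheme.IsRegular C.subscheme :=
  ((CentreSeq.isAdmissibleFor_cons C rest M).mp G.res.1).2.2.1

/-- [OURS] The head centre lies in the support of the marked ideal. -/
theorem support_head_subset : (C.support : Set Y) ⊆ M.support :=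
  ((CentreSeq.isAdmissibleFor_cons C rest M).mp G.res.1).1

/-- [OURS] The head centre is not empty. -/
theorem head_ne_top : C ≠ ⊤ := ((CentreSeq.noEmptyCentres_cons C rest).mp G.noEmpty).1

/-- [OURS] **The head centre is stable under the chart symmetries.** -/
theorem comap_head_eq {c : Chart L Y} (hc : c ∈ 𝒞) (t : L → ℚ) (ht : ∀ b, t b ≠ 0) :
    ∃ (g : Y ≅ Y) (h : (c.U : Y.Opens) ≤ g.hom ⁻¹ᵁ (c.U : Y.Opens)),
      (∀ f, c.e ((g.hom.appLE c.U c.U h).hom f) = scaleHom t (c.e f)) ∧ C.comap g.hom = C := by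
  obtain ⟨g, h, happ, hpb, -⟩ := G.sym c hc t ht
  exact ⟨g, h, happ, ((CentreSeq.isPullbackAlong_cons_cons _ _ _ _ _).mp hpb).1.symm⟩

/-- [OURS] **The chart image of the head centre is stable under all torus scalings.** -/
theorem img_head_stable {c : Chart L Y} (hc : c ∈ 𝒞) (t : L → ℚ) (ht : ∀ b, t b ≠ 0) :
    ∀ f ∈ c.img C, scaleHom t f ∈ c.img C := by
  obtain ⟨g, h, happ, hC⟩ := G.comap_head_eq hc t ht
  -- `C(U) = C(U) · (g^*)`, read through `e`
  have hsec : C.ideal c.U = (C.ideal c.U).map (g.hom.appLE c.U c.U h).hom := by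
    conv_lhs => rw [← hC]
    exact ideal_comap_of_le g.hom C c.U c.U h
  intro f hf
  rw [Chart.mem_img_iff] at hf ⊢
  have h1 : (g.hom.appLE c.U c.U h).hom (c.e.symm f) ∈ C.ideal c.U := by
    rw [hsec]; exact Ideal.mem_map_of_mem _ hf
  have h2 : c.e ((g.hom.appLE c.U c.U h).hom (c.e.symm f)) = scaleHom t f := by
    rw [happ, RingEquiv.apply_symm_apply]
  rw [← h2, RingEquiv.symm_apply_apply]
  exact h1

/-- [OURS] A chart SEES the stratum `J` as the head centre: `C` is read as `(x_S)` with `S ≠ ∅` and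
`J` the labels of `S`. -/
def _root_.Summit.ResolutionOfSingularities.ResolutionOfSingularities.Theorems.PolyhedraGame.RouteK.Chart.Sees
    (c : Chart L Y) (C : Y.IdealSheafData) (J : Finset ℕ) : Prop :=
  ∃ S : Finset L, S.Nonempty ∧ c.img C = coordIdeal S ∧ J = c.labels S

omit G in
/-- [OURS] `coordIdeal` is injective. -/
theorem coordIdeal_injective [DecidableEq L] (G : Good L m s Y D M (CentreSeq.cons C rest) 𝒞)
    {S S' : Finset L} (h : coordIdeal (K := ℚ) S = coordIdeal S') : S = S' := by
  ext b
  rw [← G.X_mem_coordIdeal_iff S b, ← G.X_mem_coordIdeal_iff S' b, h]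

/-- [OURS] **Every chart reads the head centre as one non-empty coordinate stratum, or does not meet
it** (needs `m ≥ 1` and `s` well-formed: the centre cannot contain a chart). -/
theorem exists_sees_or_top [DecidableEq L] (hm : 1 ≤ m) (hs : s.WF) {c : Chart L Y} (hc : c ∈ 𝒞) :
    c.img C = ⊤ ∨ ∃ J, c.Sees C J := by
  haveI := G.locNoeth
  by_cases htop : c.img C = ⊤
  · exact Or.inl htop
  right
  obtain ⟨S, hS, -⟩ := c.exists_img_eq_coordIdeal G.isRegular_head (G.img_head_stable hc) htop
  refine ⟨c.labels S, S, ?_, hS, rfl⟩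
  -- `S ≠ ∅`: otherwise the generic point of the chart lies in `supp C ⊆ supp (M, m)`, `m ≥ 1`
  rw [Finset.nonempty_iff_ne_empty]
  rintro rfl
  haveI := coordIdeal_isPrime (K := ℚ) (∅ : Finset L)
  have hy : c.point (coordIdeal (K := ℚ) (∅ : Finset L)) ∈ M.support :=
    G.support_head_subset ((c.point_mem_support_iff _ C).mpr hS.le)
  obtain ⟨α, hα⟩ := hs.nonempty
  have hM : M = ⟨M.ideal, M.boundary, M.mult⟩ := rfl
  rw [hM, G.mult] at hy
  have := (c.point_coordIdeal_mem_markedSupport_iff ∅ s.A M.ideal (G.img_M c hc) M.boundary m).mp hy α hα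
  simp [sdeg] at this
  omega

/-- [OURS] A chart meeting the head centre sees a component. -/
theorem exists_sees_of_mem [DecidableEq L] (hm : 1 ≤ m) (hs : s.WF) {c : Chart L Y} (hc : c ∈ 𝒞) {y : Y}
    (hyU : y ∈ (c.U : Y.Opens)) (hyC : y ∈ C.support) : ∃ J, c.Sees C J := by
  rcases G.exists_sees_or_top hm hs hc with htop | h
  · exfalso
    obtain ⟨P, hP, rfl⟩ := exists_point_eq c hyU
    rw [c.point_mem_support_iff, htop, top_le_iff] at hyC
    exact hP.ne_top hyC
  · exact h

/-- [OURS] **Consistency of the charts**: a chart whose cone contains a stratum seen (by some chart)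
as the head centre sees it too. -/
theorem Sees.of_subset_cone [DecidableEq L] (hm : 1 ≤ m) (hs : s.WF) {c c' : Chart L Y} (hc : c ∈ 𝒞)
    (hc' : c' ∈ 𝒞) {J : Finset ℕ} (hJ : c'.Sees C J) (hJc : J ⊆ c.cone) : c.Sees C J := by
  obtain ⟨S', hS'ne, hS', rfl⟩ := hJ
  haveI := coordIdeal_isPrime (K := ℚ) S'
  -- the exact point of `J` in `c'` lies in `c`, on `C`, with divisors exactly `J`
  have hy'C : c'.point (coordIdeal (K := ℚ) S') ∈ C.support := (c'.point_mem_support_iff _ C).mpr hS'.le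
  have hy'U : c'.point (coordIdeal (K := ℚ) S') ∈ (c.U : Y.Opens) := G.point_coordIdeal_mem_U hc' hc S' hJc
  obtain ⟨J₁, S, hSne, hS, rfl⟩ := G.exists_sees_of_mem hm hs hc hy'U hy'C
  haveI := coordIdeal_isPrime (K := ℚ) S
  -- reading a point of `supp C` lying in a chart that sees `(x_T)`: its divisors contain the labels of `T`
  have key : ∀ {c₁ c₂ : Chart L Y}, c₁ ∈ 𝒞 → c₂ ∈ 𝒞 → ∀ {T₁ T₂ : Finset L},
      c₁.img C = coordIdeal T₁ →
      (haveI := coordIdeal_isPrime (K := ℚ) T₂; c₂.point (coordIdeal T₂)) ∈ (c₁.U : Y.Opens) →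
      (haveI := coordIdeal_isPrime (K := ℚ) T₂; c₂.point (coordIdeal T₂)) ∈ C.support →
      c₁.labels T₁ ⊆ c₂.labels T₂ := by
    intro c₁ c₂ hc₁ hc₂ T₁ T₂ hT₁ hyU hyC l hl
    haveI := coordIdeal_isPrime (K := ℚ) T₂
    obtain ⟨b, hb, rfl⟩ := Finset.mem_image.mp hl
    obtain ⟨P, hP, hPy⟩ := exists_point_eq c₁ hyU
    have h1 : c₁.img C ≤ P := (c₁.point_mem_support_iff P C).mp (hPy ▸ hyC)
    rw [hT₁] at h1
    have h2 : c₁.img (D (c₁.lab b)) ≤ P := by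
      rw [G.img_D c₁ hc₁ b, Ideal.span_singleton_le_iff_mem]
      exact h1 ((G.X_mem_coordIdeal_iff T₁ b).mpr hb)
    have h3 : c₁.point P ∈ (D (c₁.lab b)).support := (c₁.point_mem_support_iff P _).mpr h2
    rw [hPy] at h3
    exact (G.point_coordIdeal_mem_support_iff hc₂ T₂ _).mp h3
  have hsup : c.labels S ⊆ c'.labels S' := key hc hc' hS hy'U hy'C
  refine ⟨S, hSne, hS, Finset.Subset.antisymm ?_ hsup⟩
  -- the exact point of `S` (chart `c`) lies in `c'`
  have hzU : c.point (coordIdeal (K := ℚ) S) ∈ (c'.U : Y.Opens) :=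
    G.point_coordIdeal_mem_U hc hc' S (hsup.trans (c'.labels_subset_cone S'))
  have hzC : c.point (coordIdeal (K := ℚ) S) ∈ C.support := (c.point_mem_support_iff _ C).mpr hS.le
  exact key hc' hc hS' hzU hzC

/-! ## The components of the head centre -/

open Classical in
/-- [OURS · W5.2 M2-strong · Route K] **The components of the head centre**, as game strata: the
strata seen by some chart as the head centre. -/
def components (G : Good L m s Y D M (CentreSeq.cons C rest) 𝒞) : Finset (Finset ℕ) :=
  have _ := G
  s.Str.filter fun J => ∃ c ∈ 𝒞, c.Sees C J

/-- [OURS] Membership in the components. -/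
theorem mem_components_iff {J : Finset ℕ} : J ∈ G.components ↔ J ∈ s.Str ∧ ∃ c ∈ 𝒞, c.Sees C J := by
  classical
  unfold components
  rw [Finset.mem_filter]

/-- [OURS] A stratum seen by a chart is a component. -/
theorem mem_components_of_sees (hs : s.WF) {c : Chart L Y} (hc : c ∈ 𝒞) {J : Finset ℕ}
    (hJ : c.Sees C J) : J ∈ G.components := by
  refine G.mem_components_iff.mpr ⟨?_, c, hc, hJ⟩
  obtain ⟨S, -, -, rfl⟩ := hJ
  exact hs.str_down _ (G.cone_mem c hc) _ (c.labels_subset_cone S)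

/-- [OURS] **The components are non-empty** (the head centre is not an empty blow-up). -/
theorem components_nonempty [DecidableEq L] (hm : 1 ≤ m) (hs : s.WF) : G.components.Nonempty := by
  -- a point of `supp C` and a chart around it
  have hne : (C.support : Set Y).Nonempty := by
    rw [Set.nonempty_iff_ne_empty]
    intro h
    apply G.head_ne_top
    rw [← Scheme.IdealSheafData.support_eq_bot_iff]
    exact TopologicalSpace.Closeds.ext h
  obtain ⟨y, hy⟩ := hne
  obtain ⟨c, hc, hyU⟩ := G.cov_pts y
  obtain ⟨J, hJ⟩ := G.exists_sees_of_mem hm hs hc hyU hy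
  exact ⟨J, G.mem_components_of_sees hs hc hJ⟩

/-- [OURS · W5.2 M2-strong · Route K] **Every component of the head centre is a PERMISSIBLE stratum**
(marking `m`): it is a non-empty stratum, and at its exact point, which lies in `supp C ⊆ supp (M, m)`,
every member has weight `≥ m`. -/
theorem permissibleM_of_mem_components [DecidableEq L] {J : Finset ℕ} (hJ : J ∈ G.components) :
    PermissibleM m s J := by
  obtain ⟨hJstr, c, hc, S, hSne, hS, rfl⟩ := G.mem_components_iff.mp hJ
  haveI := coordIdeal_isPrime (K := ℚ) S
  refine ⟨hJstr, ?_, fun α hα => ?_⟩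
  · obtain ⟨b, hb⟩ := hSne
    exact ⟨c.lab b, Finset.mem_image_of_mem _ hb⟩
  · have hy : c.point (coordIdeal (K := ℚ) S) ∈ M.support :=
      G.support_head_subset ((c.point_mem_support_iff _ C).mpr hS.le)
    have hM : M = ⟨M.ideal, M.boundary, M.mult⟩ := rfl
    rw [hM, G.mult] at hy
    rw [c.weight_labels (G.lab_inj c hc)]
    exact (c.point_coordIdeal_mem_markedSupport_iff S s.A M.ideal (G.img_M c hc) M.boundary m).mp hy α hα

/-- [OURS · W5.2 M2-strong · Route K] **Distinct components are not faces of a common stratum**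
(the head centre is a regular scheme, so a chart sees at most one component). -/
theorem union_not_mem_of_ne [DecidableEq L] (hm : 1 ≤ m) (hs : s.WF) {J J' : Finset ℕ}
    (hJ : J ∈ G.components) (hJ' : J' ∈ G.components) (hne : J ≠ J') : J ∪ J' ∉ s.Str := by
  intro hU
  obtain ⟨-, c₁, hc₁, h₁⟩ := G.mem_components_iff.mp hJ
  obtain ⟨-, c₂, hc₂, h₂⟩ := G.mem_components_iff.mp hJ'
  obtain ⟨c, hc, hJc⟩ := G.cov_str _ hU
  obtain ⟨S, -, hS, rfl⟩ := Sees.of_subset_cone G hm hs hc hc₁ h₁ (Finset.union_subset_left hJc)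
  obtain ⟨S', -, hS', rfl⟩ := Sees.of_subset_cone G hm hs hc hc₂ h₂ (Finset.union_subset_right hJc)
  exact hne (by rw [G.coordIdeal_injective (hS.symm.trans hS')])

end Head


end Good

end RouteK

end PolyhedraGame

end Summit.ResolutionOfSingularities.ResolutionOfSingularities.Theorems

end
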